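import Mathlib
import Summits.Ventures.PercRepro2.A3BStarModel

/-!
# The certificate of the star `N(o) ⊆ {a₃, b}` (blind cell PercRepro2, mine-2 g39, 2026-08-28;
`proofs/MINE2-GLUE.md` §7, row M2-83)

`cert3b`: the gadget sum `C3 t₁ 0 t_b P₁ P₂ P₃` of `A3BStarModel.lean` is nonnegative for every
typing `t₁, t_b ∈ {0, 1, 2, 3}` of the edges `o–a₃, o–b` (no edge `o–a₁`: the middle slot of type
`0`) and every sorted triple of `Q`-patterns (set partitions of `a₃, a₁, a₂, b` not joining the
roots), decided in the kernel.  Own code; standard axioms.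
-/

namespace Summit.Ventures.PercRepro2

namespace CovForm

namespace OStar

/-- **The certificate of `N(o) ⊆ {a₃, b}`**: `0 ≤ C3 t₁ 0 t_b` on every sorted triple of
`Q`-patterns, every `t₁, t_b ≤ 3`. -/
theorem cert3b : ∀ t₁ tb : Fin 4, ∀ b₁ b₂ b₃ b₄ b₅ b₆ : Bool,
    validQ3 (b₁, b₂, b₃, b₄, b₅, b₆) = true →
    ∀ c₁ c₂ c₃ c₄ c₅ c₆ : Bool, validQ3 (c₁, c₂, c₃, c₄, c₅, c₆) = true →
    key (b₁, b₂, b₃, b₄, b₅, b₆) ≤ key (c₁, c₂, c₃, c₄, c₅, c₆) →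
    ∀ d₁ d₂ d₃ d₄ d₅ d₆ : Bool, validQ3 (d₁, d₂, d₃, d₄, d₅, d₆) = true →
    key (c₁, c₂, c₃, c₄, c₅, c₆) ≤ key (d₁, d₂, d₃, d₄, d₅, d₆) →
    0 ≤ C3 t₁.val 0 tb.val (b₁, b₂, b₃, b₄, b₅, b₆) (c₁, c₂, c₃, c₄, c₅, c₆)
      (d₁, d₂, d₃, d₄, d₅, d₆) := by
  decide +kernel

end OStar

end CovForm

end Summit.Ventures.PercRepro2
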